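import Summits.ResolutionOfSingularities.ResolutionOfSingularities.Theorems.HomologicalConductorNoZenoPointBlowupH0
import Literature.AlgebraicGeometry.Resolution.RegularCentreLocal
import Literature.AlgebraicGeometry.Resolution.RegularQuotientIdeal
import Literature.AlgebraicGeometry.Resolution.ExceptionalDivisorRegularGlobal
import Literature.AlgebraicGeometry.Resolution.PointCentrePermissible
import Literature.AlgebraicGeometry.Resolution.BlowupExceptionalFibreIrreducible
import Literature.AlgebraicGeometry.Resolution.PrimeDivisorIdeals
import HarnessLib

/-!
# Crux `NoZenoR` (stmt-ResolutionOfSingularities-19943), slot 5 `stub_L1wCoreF`, (B1) UP-5 — the point blow-up: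
# `h⁰`-numerics of the exceptional curve of the blow-up of a regular closed point of a surface

OURS (cell res-hironaka, crux chain W4.4, seat res-L0-w44-stub-1 g11; object UP-5a/b of the (B1) split core of
slot 5 `stub_L1wCoreF`, res-L0-w44-stub-2 L1W-PREP §3.3 / lead B1-CENSUS-g8). Nothing here is a statement of the
manuscript under review (Hironaka 2017); AI-written, weaker than expert review. Def-free, fact-free.

The user-facing form of UP-5a/b. For a closed point `x` of a locally Noetherian scheme `X` with `𝒪_{X,x}`
regular of dimension `2`, a blowing up `ρ : X' → X` of the reduced ideal `𝓘_{x}` (`IsBlowup`, `X'` integral)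
and any `π : X → Spec S`:

* `exists_regularPair_away`, `exists_regularPair_presentation` — an affine open `W ∋ x` and `u, v ∈ Γ(X, W)`
  with `𝓘_{x}(W) = (u, v)` a regular pair in both orders (a regular system of parameters of `𝒪_{X,x}` with
  independent differentials, tree `exists_span_eq_of_isRegularLocalRing_quotient` /
  `mem_span_image_of_mul_mem_of_linearIndependent_toCotangent`, spread to `D(g)` by uniform denominators,
  tree `exists_uniform_multiplier_of_regular_at_prime` / `regularSeq_map_of_uniform_multiplier`);
* **`h0_comap_vanishingIdeal_point`** — `h0 (ρ ≫ π) (𝓘_{x}·𝒪_{X'}) = h0 π 𝓘_{x}` (UP-5a: `h⁰(F) = [κ(x) : κ_S]`);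
* **`h0_comap_vanishingIdeal_point_sq`** — `h0 (ρ ≫ π) ((𝓘_{x}·𝒪_{X'})²) = 3 · h0 π 𝓘_{x}` (UP-5b);
* **`h0_comap_vanishingIdeal_point_sq_eq_three_mul`** — `h0 (𝓘_F²) = 3 · h0 𝓘_F`: with Prop. (13.1) d)
  (`(F·F) = 2 h⁰(𝓘_F) − h⁰(𝓘_F²)`, F-97d `Lipman1969_13_1_d_rat` at `η = η'`) this is `(F·F) = −h⁰(F)`, the
  exceptional curve is OF THE FIRST KIND — the hypothesis `h0 π (𝓘 ^ 2) = 3 * h0 π 𝓘` of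
  `Lipman1969_27_1_reg_rat` for the node curves of L1W-PREP STEP 3 (2)/(4);
* `exists_primeDivisorIdeal_eq_comap_vanishingIdeal` — for `X` regular: `𝓘_{x}·𝒪_{X'} = primeDivisorIdeal η`
  for the generic point `η` of the (irreducible) fibre `ρ⁻¹{x}` (Liu Thm. 8.1.19 (b), tree
  `IsBlowup.comap_vanishingIdeal_eq_vanishingIdeal_preimage`); left to the consumer: `η ∈ excCurvePoints`.

References: J. Lipman, Publ. Math. IHÉS 36 (1969), §13 (13.1) d), §15 p. 229, §27 (27.1) [`Lipman1969`];
Q. Liu, *Algebraic Geometry…* (2002), Thm. 8.1.19 (b) [`Liu2002`]; H. Matsumura (1986), Thm. 14.2 [`Matsumura1987`].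
-/

noncomputable section

-- single-problem summit: the doubled namespace component `ResolutionOfSingularities` is forced
set_option linter.dupNamespace false

namespace Summit.ResolutionOfSingularities.ResolutionOfSingularities.Theorems.NoZeno.ExcCount.PointBlowup

open IsLocalRing Literature.AlgebraicGeometry.Resolution

universe u

/-! ## §9 A regular pair presenting `𝔪` near a regular point of codimension two (algebra) -/
section RegularPair

/-- `Set.Iio (0 : Fin 2) = ∅` and `Set.Iio (1 : Fin 2) = {0}`, as images. [folklore] -/
theorem image_Iio_fin_two {β : Type*} (f : Fin 2 → β) :
    f '' Set.Iio 0 = ∅ ∧ f '' Set.Iio 1 = {f 0} := by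
  constructor
  · rw [Set.image_eq_empty]; ext i; simp
  · ext b
    simp only [Set.mem_image, Set.mem_Iio, Set.mem_singleton_iff]
    constructor
    · rintro ⟨i, hi, rfl⟩
      have : i = 0 := by
        rcases Fin.eq_zero_or_eq_succ i with h | ⟨j, rfl⟩
        · exact h
        · exact absurd hi (by simp [Fin.lt_def])
      rw [this]
    · rintro rfl; exact ⟨0, by simp, rfl⟩

/-- **A regular pair presenting the maximal ideal, near a regular point of codimension two.** Let
`A` be Noetherian, `𝔪` a prime of `A` such that `R = A_𝔪` is a regular local ring of dimension `2`.
Then there are `g ∉ 𝔪` and `a, b ∈ 𝔪` such that in `A[1/g]`: `𝔪 A[1/g] = (a, b)`, and `(a, b)`, `(b, a)`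
are regular pairs (`a`, `b` nonzerodivisors, `a ∣ rb ⇒ a ∣ r`, `b ∣ ra ⇒ b ∣ r`). (A regular system
of parameters of `A_𝔪` chosen inside `𝔪`, which is an `A_𝔪`-sequence in every order, spread to a
neighbourhood by uniform denominators.) [cite: Matsumura1987, Thm. 14.2 with Thm. 17.4] -/
theorem exists_regularPair_away {A : Type u} [CommRing A] [IsNoetherianRing A] (𝔪 : Ideal A)
    [𝔪.IsPrime] (R : Type u) [CommRing R] [Algebra A R] [IsLocalization.AtPrime R 𝔪]
    [IsRegularLocalRing R] (hdim : ringKrullDim R = 2) :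
    ∃ g : A, g ∉ 𝔪 ∧ ∃ a b : A, a ∈ 𝔪 ∧ b ∈ 𝔪 ∧
      ∀ (L : Type u) [CommRing L] [Algebra A L] [IsLocalization.Away g L],
        𝔪.map (algebraMap A L) = Ideal.span {algebraMap A L a, algebraMap A L b} ∧
        algebraMap A L a ∈ nonZeroDivisors L ∧
        (∀ r, algebraMap A L a ∣ r * algebraMap A L b → algebraMap A L a ∣ r) ∧
        algebraMap A L b ∈ nonZeroDivisors L ∧
        (∀ r, algebraMap A L b ∣ r * algebraMap A L a → algebraMap A L b ∣ r) := by
  classical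
  have hmR : 𝔪.map (algebraMap A R) = maximalIdeal R := IsLocalization.AtPrime.map_eq_maximalIdeal 𝔪 R
  -- generators of `𝔪_R` inside the image of `𝔪`, with independent differentials
  letI : Field (R ⧸ maximalIdeal R) := Ideal.Quotient.field _
  obtain ⟨c, f, hfG, hspan, hli⟩ := exists_span_eq_of_isRegularLocalRing_quotient
    (le_refl (maximalIdeal R)) (algebraMap A R '' (𝔪 : Set A)) (by rw [← hmR]; rfl)
  have hf : ∀ i, f i ∈ maximalIdeal R := fun i => hspan ▸ Ideal.subset_span ⟨i, rfl⟩
  -- `c = 2`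
  have hfin : Module.finrank (ResidueField R) (CotangentSpace R) = 2 := by
    have h := (IsRegularLocalRing.iff_finrank_cotangentSpace R).mp inferInstance
    rw [hdim] at h
    exact_mod_cast h
  have hc2 : c = 2 := by
    apply le_antisymm
    · have := hli.fintype_card_le_finrank
      rwa [Fintype.card_fin, hfin] at this
    · by_contra hlt
      rw [not_le] at hlt
      have hsf : (maximalIdeal R).spanFinrank ≤ c := by
        rw [← hspan]
        refine (Submodule.spanFinrank_span_le_ncard_of_finite (Set.finite_range f)).trans ?_
        calc (Set.range f).ncard ≤ (Finset.univ.image f).card := by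
              rw [← Set.ncard_coe_finset, Finset.coe_image, Finset.coe_univ, Set.image_univ]
          _ ≤ Finset.univ.card := Finset.card_image_le
          _ = c := by simp
      have h2 : ((maximalIdeal R).spanFinrank : WithBot ℕ∞) = 2 := by
        rw [IsRegularLocalRing.spanFinrank_maximalIdeal, hdim]
      have : (maximalIdeal R).spanFinrank = 2 := by exact_mod_cast h2
      omega
  subst hc2
  obtain ⟨a, ha𝔪, hfa⟩ := hfG 0
  obtain ⟨b, hb𝔪, hfb⟩ := hfG 1
  have hcol := mem_span_image_of_mul_mem_of_linearIndependent_toCotangent f hf hli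
  -- the colon properties of `(f 0, f 1)` in `R`, in both orders
  have hR0 : ∀ (i : Fin 2) (y : R), f i * y = 0 → y = 0 := by
    intro i y hy
    have h := hcol i ∅ (Set.notMem_empty i) y (by rw [Set.image_empty, Ideal.span_empty, hy]; exact zero_mem _)
    rwa [Set.image_empty, Ideal.span_empty, Ideal.mem_bot] at h
  have hR1 : ∀ (i j : Fin 2), i ≠ j → ∀ y : R, f i * y ∈ Ideal.span {f j} → y ∈ Ideal.span {f j} := by
    intro i j hij y hy
    have h := hcol i {j} (by simpa using hij) y (by rwa [Set.image_singleton])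
    rwa [Set.image_singleton] at h
  -- transfer to `A`: the hypotheses of `exists_uniform_multiplier_of_regular_at_prime` for `(a, b)`, `(b, a)`
  have htransfer : ∀ (a b : A) (i j : Fin 2), i ≠ j → algebraMap A R a = f i → algebraMap A R b = f j →
      ∀ (k : Fin 2) (y : A), ![a, b] k * y ∈ Ideal.span (![a, b] '' Set.Iio k) →
        ∃ s : A, s ∉ 𝔪 ∧ s * y ∈ Ideal.span (![a, b] '' Set.Iio k) := by
    intro a b i j hij hfa hfb k y hy
    obtain ⟨h0, h1⟩ := image_Iio_fin_two ![a, b]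
    rcases Fin.eq_zero_or_eq_succ k with rfl | ⟨k', rfl⟩
    · -- `a y = 0` in `A` ⇒ `f i · y = 0` in `R` ⇒ `y = 0` in `R` ⇒ `s y = 0`
      rw [h0, Ideal.span_empty, Ideal.mem_bot] at hy
      have hy' : algebraMap A R y = 0 := by
        refine hR0 i _ ?_
        rw [← hfa, ← map_mul]; exact (congr_arg _ hy).trans (map_zero _)
      obtain ⟨⟨s, hs⟩, hsy⟩ := (IsLocalization.map_eq_zero_iff 𝔪.primeCompl R y).mp hy'
      exact ⟨s, hs, by rw [h0, Ideal.span_empty, Ideal.mem_bot]; exact hsy⟩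
    · have hk' : k' = 0 := Fin.eq_zero k'
      subst hk'
      change ![a, b] 1 * y ∈ Ideal.span (![a, b] '' Set.Iio 1) at hy
      change ∃ s, s ∉ 𝔪 ∧ s * y ∈ Ideal.span (![a, b] '' Set.Iio 1)
      rw [h1] at hy ⊢
      change b * y ∈ Ideal.span {a} at hy
      change ∃ s, s ∉ 𝔪 ∧ s * y ∈ Ideal.span {a}
      have hy' : algebraMap A R y ∈ Ideal.span {f i} := by
        refine hR1 j i hij.symm _ ?_
        rw [← hfb, ← map_mul, ← hfa, ← Set.image_singleton, ← Ideal.map_span]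
        exact Ideal.mem_map_of_mem _ hy
      rw [← hfa, ← Set.image_singleton, ← Ideal.map_span,
        IsLocalization.algebraMap_mem_map_algebraMap_iff 𝔪.primeCompl] at hy'
      obtain ⟨s, hs, hsy⟩ := hy'
      exact ⟨s, hs, hsy⟩
  obtain ⟨g₁, hg₁𝔪, hg₁⟩ := exists_uniform_multiplier_of_regular_at_prime ![a, b] 𝔪
    (htransfer a b 0 1 zero_ne_one hfa hfb)
  obtain ⟨g₂, hg₂𝔪, hg₂⟩ := exists_uniform_multiplier_of_regular_at_prime ![b, a] 𝔪
    (htransfer b a 1 0 one_ne_zero hfb hfa)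
  -- generation: `𝔪 A[1/g₃] = (a, b)`
  obtain ⟨gens, hgens⟩ := (IsNoetherian.noetherian 𝔪 : 𝔪.FG)
  have hspanR : Ideal.span {f 0, f 1} = (Ideal.span {a, b}).map (algebraMap A R) := by
    rw [Ideal.map_span, Set.image_insert_eq, Set.image_singleton, hfa, hfb]
  have hrange : Set.range f = {f 0, f 1} := by
    ext x; simp only [Set.mem_range, Set.mem_insert_iff, Set.mem_singleton_iff]
    constructor
    · rintro ⟨i, rfl⟩
      rcases Fin.eq_zero_or_eq_succ i with rfl | ⟨k', rfl⟩
      · exact Or.inl rfl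
      · rw [Fin.eq_zero k']; exact Or.inr rfl
    · rintro (rfl | rfl); exacts [⟨0, rfl⟩, ⟨1, rfl⟩]
  have hgen1 : ∀ x : A, x ∈ gens → ∃ t : A, t ∉ 𝔪 ∧ t * x ∈ Ideal.span {a, b} := by
    intro x hx
    have hx𝔪 : x ∈ 𝔪 := hgens ▸ Submodule.subset_span hx
    have h1 : algebraMap A R x ∈ (Ideal.span {a, b}).map (algebraMap A R) := by
      rw [← hspanR, ← hrange, hspan, ← hmR]
      exact Ideal.mem_map_of_mem _ hx𝔪
    rw [IsLocalization.algebraMap_mem_map_algebraMap_iff 𝔪.primeCompl] at h1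
    obtain ⟨t, ht, htx⟩ := h1
    exact ⟨t, ht, htx⟩
  choose! t ht using hgen1
  have hg₃𝔪 : (∏ x ∈ gens, t x) ∉ 𝔪 := by
    intro hmem
    obtain ⟨x, hx, htx⟩ := (Ideal.IsPrime.prod_mem_iff.mp hmem)
    exact (ht x hx).1 htx
  refine ⟨g₁ * g₂ * ∏ x ∈ gens, t x, ?_, a, b, ha𝔪, hb𝔪, ?_⟩
  · intro hmem
    rcases (Ideal.IsPrime.mem_or_mem inferInstance hmem) with h12 | h3
    · rcases (Ideal.IsPrime.mem_or_mem inferInstance h12) with h1 | h2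
      exacts [hg₁𝔪 h1, hg₂𝔪 h2]
    · exact hg₃𝔪 h3
  intro L _ _ _
  set g := g₁ * g₂ * ∏ x ∈ gens, t x with hgdef
  have hgu : IsUnit (algebraMap A L g) := IsLocalization.Away.algebraMap_isUnit g
  have hunit_of_dvd : ∀ s : A, s ∣ g → IsUnit (algebraMap A L s) := fun s hs =>
    isUnit_of_dvd_unit (map_dvd (algebraMap A L) hs) hgu
  -- uniform multipliers for `g`
  have hG₁ : ∀ (i : Fin 2) (y : A), ![a, b] i * y ∈ Ideal.span (![a, b] '' Set.Iio i) →
      g * y ∈ Ideal.span (![a, b] '' Set.Iio i) := fun i y hy => by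
    have : g * y = (g₂ * ∏ x ∈ gens, t x) * (g₁ * y) := by rw [hgdef]; ring
    rw [this]
    exact Ideal.mul_mem_left _ _ (hg₁ i y hy)
  have hG₂ : ∀ (i : Fin 2) (y : A), ![b, a] i * y ∈ Ideal.span (![b, a] '' Set.Iio i) →
      g * y ∈ Ideal.span (![b, a] '' Set.Iio i) := fun i y hy => by
    have : g * y = (g₁ * ∏ x ∈ gens, t x) * (g₂ * y) := by rw [hgdef]; ring
    rw [this]
    exact Ideal.mul_mem_left _ _ (hg₂ i y hy)
  obtain ⟨hab0, hab1⟩ := image_Iio_fin_two (algebraMap A L ∘ ![a, b])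
  obtain ⟨hba0, hba1⟩ := image_Iio_fin_two (algebraMap A L ∘ ![b, a])
  refine ⟨?_, ?_, ?_, ?_, ?_⟩
  · -- generation
    apply le_antisymm
    · rw [← hgens, Ideal.map_span, Ideal.span_le]
      rintro _ ⟨x, hx, rfl⟩
      obtain ⟨htx, hmem⟩ := ht x hx
      have hdvd : t x ∣ g := by
        rw [hgdef]
        exact Dvd.dvd.mul_left (Finset.dvd_prod_of_mem t hx) _
      have := Ideal.mem_map_of_mem (algebraMap A L) hmem
      rw [map_mul, Ideal.map_span, Set.image_insert_eq, Set.image_singleton] at this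
      exact (Ideal.unit_mul_mem_iff_mem _ (hunit_of_dvd (t x) hdvd)).mp this
    · rw [Ideal.span_le]
      intro z hz
      rcases hz with rfl | hz
      · exact Ideal.mem_map_of_mem _ ha𝔪
      · rw [Set.mem_singleton_iff] at hz
        rw [hz]
        exact Ideal.mem_map_of_mem _ hb𝔪
  · refine mem_nonZeroDivisors_iff_right.mpr fun z hz => ?_
    have h := regularSeq_map_of_uniform_multiplier ![a, b] hG₁ L 0 z
      (by rw [hab0, Ideal.span_empty, Ideal.mem_bot]; simpa [mul_comm] using hz)
    rwa [hab0, Ideal.span_empty, Ideal.mem_bot] at h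
  · intro r hr
    rw [← Ideal.mem_span_singleton]
    have h := regularSeq_map_of_uniform_multiplier ![a, b] hG₁ L 1 r (by
      rw [hab1]
      change algebraMap A L b * r ∈ Ideal.span {algebraMap A L a}
      rw [mul_comm]; exact Ideal.mem_span_singleton.mpr hr)
    rwa [hab1] at h
  · refine mem_nonZeroDivisors_iff_right.mpr fun z hz => ?_
    have h := regularSeq_map_of_uniform_multiplier ![b, a] hG₂ L 0 z
      (by rw [hba0, Ideal.span_empty, Ideal.mem_bot]; simpa [mul_comm] using hz)
    rwa [hba0, Ideal.span_empty, Ideal.mem_bot] at h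
  · intro r hr
    rw [← Ideal.mem_span_singleton]
    have h := regularSeq_map_of_uniform_multiplier ![b, a] hG₂ L 1 r (by
      rw [hba1]
      change algebraMap A L a * r ∈ Ideal.span {algebraMap A L b}
      rw [mul_comm]; exact Ideal.mem_span_singleton.mpr hr)
    rwa [hba1] at h

end RegularPair

/-! ## §10 A regular closed point of a surface: an affine neighbourhood with a regular pair -/

section RegularPoint

open CategoryTheory AlgebraicGeometry TopologicalSpace Opposite

/-- **Near a closed point `x` with `𝒪_{X,x}` regular of dimension `2`, the reduced ideal of `x` is
generated by a regular pair on an affine neighbourhood**: an affine open `W ∋ x` and `u, v ∈ Γ(X, W)`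
with `𝓘_{x}(W) = (u, v)`, `(u, v)` and `(v, u)` regular pairs, `(u, v) ≠ Γ(X, W)`. [folklore] -/
theorem exists_regularPair_presentation {X : Scheme.{u}} [IsLocallyNoetherian X] (x : X)
    (hx : IsClosed ({x} : Set X)) [IsRegularLocalRing (X.presheaf.stalk x)]
    (hdim : ringKrullDim (X.presheaf.stalk x) = 2) :
    ∃ (W : X.affineOpens) (u v : Γ(X, W)),
      ((Scheme.IdealSheafData.vanishingIdeal ⟨{x}, hx⟩).support : Set X) ⊆ (W : X.Opens) ∧
      (Scheme.IdealSheafData.vanishingIdeal ⟨{x}, hx⟩).ideal W = Ideal.span {u, v} ∧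
      u ∈ nonZeroDivisors Γ(X, W) ∧ (∀ r, u ∣ r * v → u ∣ r) ∧
      v ∈ nonZeroDivisors Γ(X, W) ∧ (∀ r, v ∣ r * u → v ∣ r) ∧ Ideal.span {u, v} ≠ ⊤ := by
  obtain ⟨U, hU, hxU, -⟩ := exists_isAffineOpen_mem_and_subset (X := X) (x := x) (U := ⊤)
    (Opens.mem_top x)
  set p := hU.primeIdealOf ⟨x, hxU⟩ with hp
  letI : Algebra Γ(X, U) (X.presheaf.stalk x) :=
    TopCat.Presheaf.algebra_section_stalk X.presheaf (⟨x, hxU⟩ : U)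
  haveI : IsLocalization.AtPrime (X.presheaf.stalk x) p.asIdeal := hU.isLocalization_stalk ⟨x, hxU⟩
  haveI : IsNoetherianRing Γ(X, U) := IsLocallyNoetherian.component_noetherian ⟨U, hU⟩
  obtain ⟨g, hg, a, b, ha, hb, H⟩ :=
    exists_regularPair_away p.asIdeal (X.presheaf.stalk x) hdim
  haveI := hU.isLocalization_basicOpen g
  obtain ⟨hgen, hua, hdiva, hub, hdivb⟩ := H Γ(X, X.basicOpen g)
  have hpx : hU.fromSpec p = x := hU.fromSpec_primeIdealOf ⟨x, hxU⟩
  -- the ideal of `x` on `U` is `p`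
  have hJU : (Scheme.IdealSheafData.vanishingIdeal ⟨{x}, hx⟩).ideal ⟨U, hU⟩ = p.asIdeal := by
    rw [Scheme.IdealSheafData.vanishingIdeal_ideal]
    have : hU.fromSpec ⁻¹' ({x} : Set X) = {p} := by
      ext q
      simp only [Set.mem_preimage, Set.mem_singleton_iff]
      constructor
      · intro hq
        exact hU.fromSpec.isOpenEmbedding.injective (hq.trans hpx.symm)
      · rintro rfl; exact hpx
    exact (congr_arg PrimeSpectrum.vanishingIdeal this).trans (PrimeSpectrum.vanishingIdeal_singleton p)
  refine ⟨X.affineBasicOpen (U := ⟨U, hU⟩) g, algebraMap Γ(X, U) Γ(X, X.basicOpen g) a,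
    algebraMap Γ(X, U) Γ(X, X.basicOpen g) b, ?_, ?_, hua, hdiva, hub, hdivb, ?_⟩
  · -- `supp 𝓘_{x} = {x} ⊆ D(g)`
    intro y hy
    rw [Scheme.IdealSheafData.coe_support_vanishingIdeal] at hy
    change y ∈ ({x} : Set X) at hy
    rw [Set.mem_singleton_iff] at hy
    rw [hy]
    change x ∈ X.basicOpen g
    have : p ∈ hU.fromSpec ⁻¹ᵁ X.basicOpen g := by
      rw [hU.fromSpec_preimage_basicOpen]; exact hg
    rw [← hpx]
    exact this
  · rw [← (Scheme.IdealSheafData.vanishingIdeal ⟨{x}, hx⟩).map_ideal_basicOpen ⟨U, hU⟩ g, hJU]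
    exact hgen
  · have hprime := IsLocalization.isPrime_of_isPrime_disjoint (Submonoid.powers g)
      Γ(X, X.basicOpen g) p.asIdeal p.isPrime ((Ideal.disjoint_powers_iff_notMem_of_isPrime g).mpr hg)
    rw [hgen] at hprime
    exact hprime.ne_top

end RegularPoint

/-! ## §11 UP-5a/b for the blow-up of a regular closed point of a surface -/

section PointBlowup

open CategoryTheory AlgebraicGeometry TopologicalSpace Opposite Literature.AlgebraicGeometry.Morphisms

variable {S : Type u} [CommRing S] {X X' : Scheme.{u}} [IsLocallyNoetherian X] [IsIntegral X']
  (π : X ⟶ Spec (.of S)) (ρ : X' ⟶ X) (x : X) (hx : IsClosed ({x} : Set X))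
  [IsRegularLocalRing (X.presheaf.stalk x)] (hdim : ringKrullDim (X.presheaf.stalk x) = 2)
  (hρ : IsBlowup ρ (Scheme.IdealSheafData.vanishingIdeal ⟨{x}, hx⟩))

include hdim hρ in
/-- **UP-5a.** For the blowing up `ρ : X' → X` of a closed point `x` at which `X` is regular of
dimension `2` (`X'` integral), the exceptional curve `F = V(𝓘_{x}·𝒪_{X'})` has
`h⁰(𝒪_F) = h⁰(κ(x))` over any base `π : X → Spec S`: `h0 (ρ ≫ π) (𝓘_{x}·𝒪_{X'}) = h0 π 𝓘_{x}`
(`= [κ(x) : κ_S]` for `x` over the closed point of a local `S`). [this work] -/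
theorem h0_comap_vanishingIdeal_point :
    h0 (ρ ≫ π) ((Scheme.IdealSheafData.vanishingIdeal ⟨{x}, hx⟩).comap ρ) =
      h0 π (Scheme.IdealSheafData.vanishingIdeal ⟨{x}, hx⟩) := by
  obtain ⟨W, u, v, hJW, hI, hu, huv, hv, hvu, hne⟩ := exists_regularPair_presentation x hx hdim
  exact h0_comap_eq π ρ hρ W hJW hI hu huv hv hvu hne

include hdim hρ in
/-- **UP-5b.** In the same setting, the first infinitesimal neighbourhood `2F = V((𝓘_{x}·𝒪_{X'})²)` has
`h⁰(𝒪_{2F}) = 3 · h⁰(κ(x))`: `h0 (ρ ≫ π) ((𝓘_{x}·𝒪_{X'})²) = 3 · h0 π 𝓘_{x}`. [this work] -/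
theorem h0_comap_vanishingIdeal_point_sq :
    h0 (ρ ≫ π) ((Scheme.IdealSheafData.vanishingIdeal ⟨{x}, hx⟩).comap ρ ^ 2) =
      3 * h0 π (Scheme.IdealSheafData.vanishingIdeal ⟨{x}, hx⟩) := by
  obtain ⟨W, u, v, hJW, hI, hu, huv, hv, hvu, hne⟩ := exists_regularPair_presentation x hx hdim
  exact h0_comap_sq_eq π ρ hρ W hJW hI hu huv hv hvu hne

include hdim hρ in
/-- **UP-5 (the exceptional curve of a point blow-up is OF THE FIRST KIND).** With
`𝓘_F = 𝓘_{x}·𝒪_{X'}` the ideal of the exceptional curve: `h0 (ρ ≫ π) (𝓘_F ^ 2) = 3 * h0 (ρ ≫ π) 𝓘_F` —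
by Lipman's Prop. (13.1) d) (`(F·F) = 2h⁰(𝓘_F) − h⁰(𝓘_F²)`) this is `(F·F) = −h⁰(F)`, the hypothesis
`h0 π (𝓘 ^ 2) = 3 * h0 π 𝓘` of `Lipman1969_27_1_reg_rat` (for the node curves `n_x` of the (B1)
split core, L1W-PREP STEP 3 (2)/(4)). When `X` is regular, `𝓘_F` is the reduced ideal
`primeDivisorIdeal η_F` of `F = ρ⁻¹{x}` (tree `IsBlowup.comap_vanishingIdeal_eq_vanishingIdeal_preimage`,
`IsBlowup.isIrreducible_preimage_singleton`). [this work] -/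
theorem h0_comap_vanishingIdeal_point_sq_eq_three_mul :
    h0 (ρ ≫ π) ((Scheme.IdealSheafData.vanishingIdeal ⟨{x}, hx⟩).comap ρ ^ 2) =
      3 * h0 (ρ ≫ π) ((Scheme.IdealSheafData.vanishingIdeal ⟨{x}, hx⟩).comap ρ) := by
  rw [h0_comap_vanishingIdeal_point_sq π ρ x hx hdim hρ, h0_comap_vanishingIdeal_point π ρ x hx hdim hρ]

end PointBlowup

/-! ## §12 The ideal of the exceptional curve is the prime divisor ideal of its generic point -/

section Bridge

open CategoryTheory AlgebraicGeometry TopologicalSpace Opposite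

/-- **`𝓘_{x}·𝒪_{X'} = 𝓘_{E_η}` for the generic point `η` of the exceptional curve.** For the blowing up
`ρ : X' → X` of a closed point `x` of a REGULAR locally Noetherian scheme `X` with `dim 𝒪_{X,x} ≥ 1`,
the fibre `F = ρ⁻¹{x}` is irreducible (tree `IsBlowup.isIrreducible_preimage_singleton`), and the
inverse image ideal sheaf `𝓘_{x}·𝒪_{X'}` is the reduced ideal of `F` (Liu Thm. 8.1.19 (b); tree
`IsBlowup.comap_vanishingIdeal_eq_vanishingIdeal_preimage`), i.e. `primeDivisorIdeal η` for the generic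
point `η` of `F` — the currency of `excCurvePoints` / `Lipman1969_27_1_reg_rat` / `Lipman1969_13_1_d_rat`.
[cite: Liu2002, Thm. 8.1.19 (b)] -/
theorem exists_primeDivisorIdeal_eq_comap_vanishingIdeal {X X' : Scheme.{u}} [IsLocallyNoetherian X]
    (hX : Scheme.IsRegular X) {ρ : X' ⟶ X} (x : X) (hx : IsClosed ({x} : Set X))
    (hρ : IsBlowup ρ (Scheme.IdealSheafData.vanishingIdeal ⟨{x}, hx⟩))
    (hne : IsLocalRing.maximalIdeal (X.presheaf.stalk x) ≠ ⊥) :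
    ∃ η : X', closure {η} = ρ.base ⁻¹' {x} ∧
      primeDivisorIdeal η = (Scheme.IdealSheafData.vanishingIdeal ⟨{x}, hx⟩).comap ρ := by
  haveI : IsRegularLocalRing (X.presheaf.stalk x) := hX x
  have hirr : IsIrreducible (ρ.base ⁻¹' {x}) :=
    hρ.isIrreducible_preimage_singleton x (stalkIdeal_vanishingIdeal_singleton hx) hne
  have hcl : IsClosed (ρ.base ⁻¹' {x}) := hx.preimage ρ.base.hom.continuous
  refine ⟨hirr.genericPoint, hirr.closure_genericPoint hcl, ?_⟩
  rw [hρ.comap_vanishingIdeal_eq_vanishingIdeal_preimage hX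
    (isRegular_subscheme_vanishingIdeal_singleton hx)]
  unfold primeDivisorIdeal
  congr 1
  exact Closeds.ext (hirr.closure_genericPoint hcl)

end Bridge

end Summit.ResolutionOfSingularities.ResolutionOfSingularities.Theorems.NoZeno.ExcCount.PointBlowup

end
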